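import Summits.ValiantsHypothesis.ValiantsHypothesis.Theorems.FermionicJetQuadraticDcCdetPermSums

/-!
# Route `FermionicJet`, crux `QuadraticDcCdet` (stmt-ValiantsHypothesis-5343) — helper 2:
# signed cycle-count sums with two and three prescribed values

Continuation of `FermionicJetQuadraticDcCdetPermSums.lean` (bookkeeping for the coefficient
`σ ↦ sgn σ · c(σ)` of `cdetPoly`, `c` = `Equiv.Perm.numCycles`):

* `sum_sign_apply_eq_two`, `sum_sign_mul_numCycles_apply_eq_two` — closed forms of
  `Σ_{π b = a, π d = c} sgn π` and `Σ_{π b = a, π d = c} sgn π · c(π)` (`b ≠ d`) on a type with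
  `m + 2` elements, by the equality pattern of `(a, b, c, d)`: with `K_m = Σ_{𝔖_m} sgn·c`
  (`= m` for `m ≤ 1`, `(-1)^m (m-2)!` for `m ≥ 2`) and `Z_m = Σ_{𝔖_m} sgn` (`= [m ≤ 1]`), the value
  is `0` if `a = c`; `K_m + 2 Z_m` if `a = b, c = d`; `-(K_m + Z_m)` if exactly one of `a = b`,
  `c = d` holds or `(a, c) = (d, b)` (a transposition); and `K_m` otherwise;
* `sum_three_apply_eq_swap_mul`, `sum_three_apply_eq_self` — a third prescribed value
  `π q = p` (`p ≠ q`: contraction of the arc `q → p`) or `π p = p` (a fixed point) reduces to two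
  prescribed values on `{y // y ≠ q}` resp. `{y // y ≠ p}`.

These are the second partial derivatives of `cdetPoly` at matrices all of whose entries but one
are equal (the Hessian of `cdet_n` on its hypersurface, next file).
HONEST FRAMING: elementary permutation combinatorics; nothing here bears on `VP ≠ VNP` (NOT proved).
-/

noncomputable section

open Equiv Equiv.Perm Finset

-- layout Summits/ValiantsHypothesis/ValiantsHypothesis forces the duplicated namespace component
set_option linter.dupNamespace false

namespace Summit.ValiantsHypothesis.ValiantsHypothesis.Theorems.FermionicJet.NumCyclesSums

universe u

variable {β : Type u} [Fintype β] [DecidableEq β] {R : Type*} [CommRing R]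

/-- Cardinality of the doubly punctured type. -/
theorem card_subtype_ne_ne {m : ℕ} (hβ : Fintype.card β = m + 2) {b d : β} (hdb : d ≠ b) :
    Fintype.card {y : {y // y ≠ b} // y ≠ ⟨d, hdb⟩} = m := by
  rw [card_subtype_ne, card_subtype_ne, hβ]; omega

omit [Fintype β] in
/-- Nested conditions as an iterated `if`. -/
theorem ite_and_eq {P Q : Prop} [Decidable P] [Decidable Q] (x : R) :
    (if P ∧ Q then x else 0) = if P then (if Q then x else 0) else 0 := by
  split_ifs <;> tauto

/-- Negation pulled out of a conditional sum. -/
theorem sum_ite_neg {ι : Type*} (s : Finset ι) (P : ι → Prop) [DecidablePred P] (f : ι → R) :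
    (∑ i ∈ s, if P i then -f i else 0) = -∑ i ∈ s, if P i then f i else 0 := by
  rw [← Finset.sum_neg_distrib]
  exact Finset.sum_congr rfl fun i _ => (apply_ite Neg.neg (P i) (f i) 0).trans (by rw [neg_zero])
                                          |>.symm

omit [Fintype β] in
/-- The pattern coefficient of `K`: value `1` in the cases `a = b ∧ c = d` and "no coincidence". -/
theorem coeffK_eq_one {a b c d : β} (h : (a = b ∧ c = d) ∨ ¬((a = b ∨ c = d) ∨ (a = d ∧ c = b))) :
    (if (a = b ∧ c = d) ∨ ¬((a = b ∨ c = d) ∨ (a = d ∧ c = b)) then (1 : R) else -1) = 1 :=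
  if_pos h

omit [Fintype β] in
/-- The pattern coefficient of `K`: value `-1` otherwise. -/
theorem coeffK_eq_neg_one {a b c d : β}
    (h : ¬((a = b ∧ c = d) ∨ ¬((a = b ∨ c = d) ∨ (a = d ∧ c = b)))) :
    (if (a = b ∧ c = d) ∨ ¬((a = b ∨ c = d) ∨ (a = d ∧ c = b)) then (1 : R) else -1) = -1 :=
  if_neg h

/-- **Two prescribed values, sign only**: for `b ≠ d` on a type with `m + 2` elements,
`Σ_{π b = a, π d = c} sgn π` is `0` if `a = c`, `Z_m` for the patterns `a = b ∧ c = d` and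
"no coincidence among `a = b`, `c = d`, `(a,c) = (d,b)`", and `-Z_m` otherwise (`Z_m = [m ≤ 1]`). -/
theorem sum_sign_apply_eq_two {m : ℕ} (hβ : Fintype.card β = m + 2) {a b c d : β}
    (hbd : b ≠ d) :
    (∑ π : Perm β, if π b = a ∧ π d = c then ((Perm.sign π : ℤ) : R) else 0) =
      if a = c then 0 else
        (if (a = b ∧ c = d) ∨ ¬((a = b ∨ c = d) ∨ (a = d ∧ c = b)) then (1 : R) else -1) *
          (if m ≤ 1 then (1 : R) else 0) := by
  have hdb : d ≠ b := hbd.symm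
  have hZ : (∑ τ : Perm {y : {y // y ≠ b} // y ≠ ⟨d, hdb⟩}, ((Perm.sign τ : ℤ) : R)) =
      if m ≤ 1 then (1 : R) else 0 := sum_sign_eq m _ (card_subtype_ne_ne hβ hdb)
  by_cases hac : a = c
  · rw [if_pos hac]
    refine Finset.sum_eq_zero fun π _ => if_neg ?_
    rintro ⟨h1, h2⟩
    exact hbd (π.injective (h1.trans (hac.trans h2.symm)))
  rw [if_neg hac]
  simp_rw [ite_and_eq (P := _ = a)]
  by_cases hab : a = b
  · -- `b` is a fixed point
    have hcb : c ≠ b := fun h => hac (hab.trans h.symm)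
    have h0 : ∀ π : Perm β, (π b = a) = (π b = b) := fun π => by rw [hab]
    simp_rw [h0]
    rw [sum_perm_apply_eq_self]
    simp_rw [ofSubtype_apply_of_ne' _ hdb, sign_ofSubtype_int]
    have hcond : ∀ τ : Perm {y // y ≠ b},
        (((τ ⟨d, hdb⟩ : {y // y ≠ b}) : β) = c) = (τ ⟨d, hdb⟩ = ⟨c, hcb⟩) :=
      fun τ => propext ⟨fun h => Subtype.ext h, fun h => by rw [h]⟩
    simp_rw [hcond]
    rw [sum_sign_apply_eq, hZ]
    by_cases hcd : c = d
    · rw [if_pos (Subtype.ext hcd : (⟨c, hcb⟩ : {y // y ≠ b}) = ⟨d, hdb⟩),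
        coeffK_eq_one (Or.inl ⟨hab, hcd⟩)]
    · rw [if_neg (fun h : (⟨c, hcb⟩ : {y // y ≠ b}) = ⟨d, hdb⟩ => hcd (Subtype.ext_iff.mp h)),
        coeffK_eq_neg_one (fun h => h.elim (fun h1 => hcd h1.2) (fun h2 => h2 (Or.inl (Or.inl hab))))]
  · -- `b` is inserted before `a`
    rw [sum_perm_apply_eq_swap_mul a b]
    simp_rw [swap_mul_ofSubtype_apply_of_ne a _ hdb, sign_swap_mul_ofSubtype (Ne.symm hab ∘ Eq.symm),
      Int.cast_neg]
    by_cases hcb : c = b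
    · -- the arc `d → b`: condition `τ d = a`
      have hab' : a ≠ b := hab
      have hcond : ∀ τ : Perm {y // y ≠ b},
          ((if ((τ ⟨d, hdb⟩ : {y // y ≠ b}) : β) = a then b
            else ((τ ⟨d, hdb⟩ : {y // y ≠ b}) : β)) = c) = (τ ⟨d, hdb⟩ = ⟨a, hab'⟩) := by
        intro τ
        refine propext ⟨fun h => ?_, fun h => ?_⟩
        · by_cases h' : ((τ ⟨d, hdb⟩ : {y // y ≠ b}) : β) = a
          · exact Subtype.ext h'
          · rw [if_neg h'] at h; exact absurd (h.trans hcb) (τ ⟨d, hdb⟩).2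
        · rw [if_pos (by rw [h]), hcb]
      simp_rw [hcond]
      rw [sum_ite_neg, sum_sign_apply_eq, hZ]
      have hcd' : c ≠ d := fun h => hbd (hcb.symm.trans h)
      by_cases had : a = d
      · rw [if_pos (Subtype.ext had : (⟨a, hab'⟩ : {y // y ≠ b}) = ⟨d, hdb⟩),
          coeffK_eq_neg_one (fun h => h.elim (fun h1 => hab h1.1) (fun h2 => h2 (Or.inr ⟨had, hcb⟩)))]
        ring
      · rw [if_neg (fun h : (⟨a, hab'⟩ : {y // y ≠ b}) = ⟨d, hdb⟩ => had (Subtype.ext_iff.mp h)),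
          coeffK_eq_one (Or.inr (fun h => h.elim (fun h1 => h1.elim hab hcd') (fun h2 => had h2.1)))]
        ring
    · -- condition `τ d = c`
      have hcond : ∀ τ : Perm {y // y ≠ b},
          ((if ((τ ⟨d, hdb⟩ : {y // y ≠ b}) : β) = a then b
            else ((τ ⟨d, hdb⟩ : {y // y ≠ b}) : β)) = c) = (τ ⟨d, hdb⟩ = ⟨c, hcb⟩) := by
        intro τ
        refine propext ⟨fun h => ?_, fun h => ?_⟩
        · by_cases h' : ((τ ⟨d, hdb⟩ : {y // y ≠ b}) : β) = a
          · rw [if_pos h'] at h; exact absurd h.symm hcb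
          · rw [if_neg h'] at h; exact Subtype.ext h
        · have h2 : ((τ ⟨d, hdb⟩ : {y // y ≠ b}) : β) = c := by rw [h]
          rw [if_neg (fun h' => hac (h'.symm.trans h2)), h2]
      simp_rw [hcond]
      rw [sum_ite_neg, sum_sign_apply_eq, hZ]
      by_cases hcd : c = d
      · rw [if_pos (Subtype.ext hcd : (⟨c, hcb⟩ : {y // y ≠ b}) = ⟨d, hdb⟩),
          coeffK_eq_neg_one (fun h => h.elim (fun h1 => hab h1.1) (fun h2 => h2 (Or.inl (Or.inr hcd))))]
        ring
      · rw [if_neg (fun h : (⟨c, hcb⟩ : {y // y ≠ b}) = ⟨d, hdb⟩ => hcd (Subtype.ext_iff.mp h)),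
          coeffK_eq_one (Or.inr (fun h => h.elim (fun h1 => h1.elim hab hcd) (fun h2 => hcb h2.2)))]
        ring

omit [Fintype β] in
/-- The pattern coefficient of `Z` in the signed cycle count: `2` for `a = b ∧ c = d`. -/
theorem coeffZ_eq_two {a b c d : β} (h : a = b ∧ c = d) :
    (if a = b ∧ c = d then (2 : R) else if (a = b ∨ c = d) ∨ (a = d ∧ c = b) then -1 else 0)
      = 2 := if_pos h

omit [Fintype β] in
/-- The pattern coefficient of `Z` in the signed cycle count: `-1` for one coincidence. -/
theorem coeffZ_eq_neg_one {a b c d : β} (h : ¬(a = b ∧ c = d))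
    (h' : (a = b ∨ c = d) ∨ (a = d ∧ c = b)) :
    (if a = b ∧ c = d then (2 : R) else if (a = b ∨ c = d) ∨ (a = d ∧ c = b) then -1 else 0)
      = -1 := by rw [if_neg h, if_pos h']

omit [Fintype β] in
/-- The pattern coefficient of `Z` in the signed cycle count: `0` for no coincidence. -/
theorem coeffZ_eq_zero {a b c d : β} (h' : ¬((a = b ∨ c = d) ∨ (a = d ∧ c = b))) :
    (if a = b ∧ c = d then (2 : R) else if (a = b ∨ c = d) ∨ (a = d ∧ c = b) then -1 else 0)
      = 0 := by rw [if_neg (fun h => h' (Or.inl (Or.inl h.1))), if_neg h']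

/-- **Two prescribed values, signed cycle count**: for `b ≠ d` on a type with `m + 2` elements,
`Σ_{π b = a, π d = c} sgn π · c(π)` is `0` if `a = c`; `K_m + 2 Z_m` if `a = b ∧ c = d`;
`-(K_m + Z_m)` if exactly one of `a = b`, `c = d` holds, or if `(a, c) = (d, b)`; and `K_m` in
the remaining cases (a path `d → c = b → a`, `b → a = d → c`, or two disjoint arcs), where
`K_m = Σ_{𝔖_m} sgn · c` (`m` for `m ≤ 1`, `(-1)^m (m-2)!` else) and `Z_m = [m ≤ 1]`. -/
theorem sum_sign_mul_numCycles_apply_eq_two {m : ℕ} (hβ : Fintype.card β = m + 2)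
    {a b c d : β} (hbd : b ≠ d) :
    (∑ π : Perm β, if π b = a ∧ π d = c then
        ((Perm.sign π : ℤ) : R) * (π.numCycles : R) else 0) =
      if a = c then 0 else
        (if (a = b ∧ c = d) ∨ ¬((a = b ∨ c = d) ∨ (a = d ∧ c = b)) then (1 : R) else -1) *
            (if m ≤ 1 then (m : R) else (-1) ^ m * ((m - 2).factorial : R)) +
          (if a = b ∧ c = d then (2 : R) else if (a = b ∨ c = d) ∨ (a = d ∧ c = b) then -1
            else 0) * (if m ≤ 1 then (1 : R) else 0) := by
  have hdb : d ≠ b := hbd.symm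
  have hZ : (∑ τ : Perm {y : {y // y ≠ b} // y ≠ ⟨d, hdb⟩}, ((Perm.sign τ : ℤ) : R)) =
      if m ≤ 1 then (1 : R) else 0 := sum_sign_eq m _ (card_subtype_ne_ne hβ hdb)
  have hK : (∑ τ : Perm {y : {y // y ≠ b} // y ≠ ⟨d, hdb⟩},
      ((Perm.sign τ : ℤ) : R) * (τ.numCycles : R)) =
      if m ≤ 1 then (m : R) else (-1) ^ m * ((m - 2).factorial : R) :=
    sum_sign_mul_numCycles_eq m _ (card_subtype_ne_ne hβ hdb)
  by_cases hac : a = c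
  · rw [if_pos hac]
    refine Finset.sum_eq_zero fun π _ => if_neg ?_
    rintro ⟨h1, h2⟩
    exact hbd (π.injective (h1.trans (hac.trans h2.symm)))
  rw [if_neg hac]
  simp_rw [ite_and_eq (P := _ = a)]
  by_cases hab : a = b
  · have hcb : c ≠ b := fun h => hac (hab.trans h.symm)
    have h0 : ∀ π : Perm β, (π b = a) = (π b = b) := fun π => by rw [hab]
    simp_rw [h0]
    rw [sum_perm_apply_eq_self]
    simp_rw [ofSubtype_apply_of_ne' _ hdb, sign_ofSubtype_int, numCycles_ofSubtype_ne]
    have hcond : ∀ τ : Perm {y // y ≠ b},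
        (((τ ⟨d, hdb⟩ : {y // y ≠ b}) : β) = c) = (τ ⟨d, hdb⟩ = ⟨c, hcb⟩) :=
      fun τ => propext ⟨fun h => Subtype.ext h, fun h => by rw [h]⟩
    simp_rw [hcond]
    have hsplit : (∑ τ : Perm {y // y ≠ b}, if τ ⟨d, hdb⟩ = ⟨c, hcb⟩ then
          ((Perm.sign τ : ℤ) : R) * ((τ.numCycles + 1 : ℕ) : R) else 0) =
        (∑ τ : Perm {y // y ≠ b}, if τ ⟨d, hdb⟩ = ⟨c, hcb⟩ then
          ((Perm.sign τ : ℤ) : R) * (τ.numCycles : R) else 0) +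
        ∑ τ : Perm {y // y ≠ b}, if τ ⟨d, hdb⟩ = ⟨c, hcb⟩ then ((Perm.sign τ : ℤ) : R) else 0 := by
      rw [← Finset.sum_add_distrib]
      refine Finset.sum_congr rfl fun τ _ => ?_
      by_cases h : τ ⟨d, hdb⟩ = ⟨c, hcb⟩
      · rw [if_pos h, if_pos h, if_pos h]; push_cast; ring
      · rw [if_neg h, if_neg h, if_neg h, add_zero]
    rw [hsplit, sum_sign_mul_numCycles_apply_eq, sum_sign_apply_eq, hZ, hK]
    by_cases hcd : c = d
    · have e : (⟨c, hcb⟩ : {y // y ≠ b}) = ⟨d, hdb⟩ := Subtype.ext hcd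
      rw [if_pos e, if_pos e, coeffK_eq_one (Or.inl ⟨hab, hcd⟩), coeffZ_eq_two ⟨hab, hcd⟩]; ring
    · have e : (⟨c, hcb⟩ : {y // y ≠ b}) ≠ ⟨d, hdb⟩ := fun h => hcd (Subtype.ext_iff.mp h)
      rw [if_neg e, if_neg e,
        coeffK_eq_neg_one (fun h => h.elim (fun h1 => hcd h1.2) (fun h2 => h2 (Or.inl (Or.inl hab)))),
        coeffZ_eq_neg_one (fun h => hcd h.2) (Or.inl (Or.inl hab))]
      ring
  · rw [sum_perm_apply_eq_swap_mul a b]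
    simp_rw [swap_mul_ofSubtype_apply_of_ne a _ hdb, sign_swap_mul_ofSubtype (Ne.symm hab ∘ Eq.symm),
      numCycles_swap_mul_ofSubtype (Ne.symm hab ∘ Eq.symm), Int.cast_neg, neg_mul]
    by_cases hcb : c = b
    · have hab' : a ≠ b := hab
      have hcond : ∀ τ : Perm {y // y ≠ b},
          ((if ((τ ⟨d, hdb⟩ : {y // y ≠ b}) : β) = a then b
            else ((τ ⟨d, hdb⟩ : {y // y ≠ b}) : β)) = c) = (τ ⟨d, hdb⟩ = ⟨a, hab'⟩) := by
        intro τ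
        refine propext ⟨fun h => ?_, fun h => ?_⟩
        · by_cases h' : ((τ ⟨d, hdb⟩ : {y // y ≠ b}) : β) = a
          · exact Subtype.ext h'
          · rw [if_neg h'] at h; exact absurd (h.trans hcb) (τ ⟨d, hdb⟩).2
        · rw [if_pos (by rw [h]), hcb]
      simp_rw [hcond]
      rw [sum_ite_neg, sum_sign_mul_numCycles_apply_eq, hZ, hK]
      have hcd' : c ≠ d := fun h => hbd (hcb.symm.trans h)
      by_cases had : a = d
      · have e : (⟨a, hab'⟩ : {y // y ≠ b}) = ⟨d, hdb⟩ := Subtype.ext had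
        rw [if_pos e, if_pos e,
          coeffK_eq_neg_one (fun h => h.elim (fun h1 => hab h1.1) (fun h2 => h2 (Or.inr ⟨had, hcb⟩))),
          coeffZ_eq_neg_one (fun h => hab h.1) (Or.inr ⟨had, hcb⟩)]
        ring
      · have e : (⟨a, hab'⟩ : {y // y ≠ b}) ≠ ⟨d, hdb⟩ := fun h => had (Subtype.ext_iff.mp h)
        have hno : ¬((a = b ∨ c = d) ∨ (a = d ∧ c = b)) :=
          fun h => h.elim (fun h1 => h1.elim hab hcd') (fun h2 => had h2.1)
        rw [if_neg e, if_neg e, coeffK_eq_one (Or.inr hno), coeffZ_eq_zero hno]; ring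
    · have hcond : ∀ τ : Perm {y // y ≠ b},
          ((if ((τ ⟨d, hdb⟩ : {y // y ≠ b}) : β) = a then b
            else ((τ ⟨d, hdb⟩ : {y // y ≠ b}) : β)) = c) = (τ ⟨d, hdb⟩ = ⟨c, hcb⟩) := by
        intro τ
        refine propext ⟨fun h => ?_, fun h => ?_⟩
        · by_cases h' : ((τ ⟨d, hdb⟩ : {y // y ≠ b}) : β) = a
          · rw [if_pos h'] at h; exact absurd h.symm hcb
          · rw [if_neg h'] at h; exact Subtype.ext h
        · have h2 : ((τ ⟨d, hdb⟩ : {y // y ≠ b}) : β) = c := by rw [h]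
          rw [if_neg (fun h' => hac (h'.symm.trans h2)), h2]
      simp_rw [hcond]
      rw [sum_ite_neg, sum_sign_mul_numCycles_apply_eq, hZ, hK]
      by_cases hcd : c = d
      · have e : (⟨c, hcb⟩ : {y // y ≠ b}) = ⟨d, hdb⟩ := Subtype.ext hcd
        rw [if_pos e, if_pos e,
          coeffK_eq_neg_one (fun h => h.elim (fun h1 => hab h1.1) (fun h2 => h2 (Or.inl (Or.inr hcd)))),
          coeffZ_eq_neg_one (fun h => hab h.1) (Or.inl (Or.inr hcd))]
        ring
      · have e : (⟨c, hcb⟩ : {y // y ≠ b}) ≠ ⟨d, hdb⟩ := fun h => hcd (Subtype.ext_iff.mp h)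
        have hno : ¬((a = b ∨ c = d) ∨ (a = d ∧ c = b)) :=
          fun h => h.elim (fun h1 => h1.elim hab hcd) (fun h2 => hcb h2.2)
        rw [if_neg e, if_neg e, coeffK_eq_one (Or.inr hno), coeffZ_eq_zero hno]; ring

/-! ### A third prescribed value -/

/-- **Contraction of an arc.** For `p ≠ q` and `b, d ≠ q`:
`Σ_{π b = a, π d = c, π q = p} F(sgn π, c(π))` is `0` if `p ∈ {a, c}` and otherwise equals the
two-value sum over `τ ∈ Perm {y // y ≠ q}` with `τ b = ρ a`, `τ d = ρ c`, weight
`F(-sgn τ, c(τ))`, where `ρ q = p` and `ρ = id` elsewhere (remove `q` from its cycle). -/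
theorem sum_three_apply_eq_swap_mul {a b c d p q : β} (hpq : p ≠ q) (hbq : b ≠ q) (hdq : d ≠ q)
    (F : ℤ → ℕ → R) :
    (∑ π : Perm β, if π b = a ∧ π d = c ∧ π q = p then F (Perm.sign π) π.numCycles else 0) =
      if a = p ∨ c = p then 0 else
        ∑ τ : Perm {y // y ≠ q},
          if ((τ ⟨b, hbq⟩ : {y // y ≠ q}) : β) = (if a = q then p else a) ∧
              ((τ ⟨d, hdq⟩ : {y // y ≠ q}) : β) = (if c = q then p else c) then
            F (-(Perm.sign τ : ℤ)) τ.numCycles else 0 := by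
  by_cases hp : a = p ∨ c = p
  · rw [if_pos hp]
    refine Finset.sum_eq_zero fun π _ => if_neg ?_
    rintro ⟨h1, h2, h3⟩
    rcases hp with h | h
    · exact hbq (π.injective (h1.trans (h.trans h3.symm)))
    · exact hdq (π.injective (h2.trans (h.trans h3.symm)))
  rw [if_neg hp]
  have hap : a ≠ p := fun h => hp (Or.inl h)
  have hcp : c ≠ p := fun h => hp (Or.inr h)
  have hre : ∀ π : Perm β, (π b = a ∧ π d = c ∧ π q = p) = (π q = p ∧ (π b = a ∧ π d = c)) :=
    fun π => propext (by tauto)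
  simp_rw [hre, ite_and_eq (P := _ = p)]
  rw [sum_perm_apply_eq_swap_mul p q]
  refine Finset.sum_congr rfl fun τ _ => ?_
  rw [swap_mul_ofSubtype_apply_of_ne p τ hbq, swap_mul_ofSubtype_apply_of_ne p τ hdq,
    sign_swap_mul_ofSubtype hpq, numCycles_swap_mul_ofSubtype hpq]
  have key : ∀ (y : {y // y ≠ q}) (e : β), e ≠ p →
      (((if (y : β) = p then q else (y : β)) = e) ↔ (y : β) = if e = q then p else e) := by
    intro y e hep
    by_cases hy : (y : β) = p
    · rw [if_pos hy, hy]
      by_cases heq : e = q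
      · rw [if_pos heq]; exact ⟨fun _ => rfl, fun _ => heq.symm⟩
      · rw [if_neg heq]; exact ⟨fun h => absurd h.symm heq, fun h => absurd h.symm hep⟩
    · rw [if_neg hy]
      by_cases heq : e = q
      · rw [if_pos heq]; exact ⟨fun h => absurd (h.trans heq) y.2, fun h => absurd h hy⟩
      · rw [if_neg heq]
  exact if_congr (Iff.and (key _ a hap) (key _ c hcp)) rfl rfl

/-- **A prescribed fixed point.** For `b, d ≠ p`:
`Σ_{π b = a, π d = c, π p = p} F(sgn π, c(π))` is `0` if `p ∈ {a, c}` and otherwise the two-value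
sum over `τ ∈ Perm {y // y ≠ p}` with `τ b = a`, `τ d = c` and weight `F(sgn τ, c(τ) + 1)`. -/
theorem sum_three_apply_eq_self {a b c d p : β} (hbp : b ≠ p) (hdp : d ≠ p) (F : ℤ → ℕ → R) :
    (∑ π : Perm β, if π b = a ∧ π d = c ∧ π p = p then F (Perm.sign π) π.numCycles else 0) =
      if a = p ∨ c = p then 0 else
        ∑ τ : Perm {y // y ≠ p},
          if ((τ ⟨b, hbp⟩ : {y // y ≠ p}) : β) = a ∧ ((τ ⟨d, hdp⟩ : {y // y ≠ p}) : β) = c then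
            F (Perm.sign τ : ℤ) (τ.numCycles + 1) else 0 := by
  by_cases hp : a = p ∨ c = p
  · rw [if_pos hp]
    refine Finset.sum_eq_zero fun π _ => if_neg ?_
    rintro ⟨h1, h2, h3⟩
    rcases hp with h | h
    · exact hbp (π.injective (h1.trans (h.trans h3.symm)))
    · exact hdp (π.injective (h2.trans (h.trans h3.symm)))
  rw [if_neg hp]
  have hre : ∀ π : Perm β, (π b = a ∧ π d = c ∧ π p = p) = (π p = p ∧ (π b = a ∧ π d = c)) :=
    fun π => propext (by tauto)
  simp_rw [hre, ite_and_eq (P := _ = p)]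
  rw [sum_perm_apply_eq_self p]
  refine Finset.sum_congr rfl fun τ _ => ?_
  rw [ofSubtype_apply_of_ne' τ hbp, ofSubtype_apply_of_ne' τ hdp, sign_ofSubtype_int,
    numCycles_ofSubtype_ne]

end Summit.ValiantsHypothesis.ValiantsHypothesis.Theorems.FermionicJet.NumCyclesSums
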